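import Literature.Geometry.Lorentzian.RadialDistanceVariation
import Literature.Geometry.Lorentzian.LocalTimeSeparation
import Literature.Geometry.Lorentzian.CausalityProofs
import Literature.Geometry.Lorentzian.CausalityConditionsProofs
import Literature.Geometry.Lorentzian.CausalityOpennessProofs
import Literature.Geometry.Lorentzian.CausalCurveNullGeodesic
import Literature.Geometry.Lorentzian.GeodesicSpeed
import Literature.Geometry.Riemannian.TwoPointExpInverse
import HarnessLib

/-!
# The vertex of a maximal broken causal geodesic (O'Neill 1983, Ch. 10, Prop. 10.46; Ch. 14,
Prop. 14.19)

Let `σ₋ : r ↦ exp_x(r a₋)` and `σ₊ : r ↦ exp_y(r a₊)`, `r ∈ [0, 1]`, be consecutive future causal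
radial geodesic segments of a strongly causal spacetime, `σ₋(1) = y`, which are **locally
maximal at the vertex `y`**: for `δ ∈ (0, 1)` and every `y'` with
`σ₋(1 - δ) ≤ y' ≤ σ₊(δ)`, `τ(σ₋(1-δ), y') + τ(y', σ₊(δ)) ≤ δ |a₋| + δ |a₊|` (the right-hand side
is the length of the broken segment from `σ₋(1-δ)` through `y` to `σ₊(δ)`). Then
(`LorentzianMetric.vertex_of_maximal`):

1. `σ₋` is timelike iff `σ₊` is timelike (a null and a timelike segment never meet in a maximal
   configuration), and
2. if they are timelike, the unit tangents agree at the vertex: `σ₋'(1)/|a₋| = a₊/|a₊|` — there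
   is no corner.

This is the corner-cutting step in O'Neill's proof of the existence of maximal geodesics
(Ch. 14, Prop. 14.19 via Ch. 10, Prop. 10.46: "if there is a corner there is a longer timelike
curve"). Proof (first variation of arc length at the vertex, O'Neill 1983, Ch. 10, Prop. 10.45
and 10.46): move the vertex along `s ↦ exp_y(s u)`; near `y` the two time separations are the
radial distances `√(-g(exp⁻¹))` from `σ₋(1-δ)` and to `σ₊(δ)` (local formula on a causally convex
normal neighbourhood, `exists_nhds_lorentzDist_eq_radial`), whose first variations are
`∓ g(u, unit tangent)` (`hasDerivAt_val_self_radial`, the Gauss lemma; the radial vectors are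
identified with `δ σ₋'(1-δ)` and `-δ σ₊'(δ)` through the injectivity of the two-point
exponential inverse, `exists_twoPoint_expInverse`). At a timelike–timelike vertex the sum is
differentiable with a local maximum, so its derivative vanishes for every `u` (Fermat), which
by nondegeneracy is (2). At a null–timelike vertex moving the vertex to the future (resp. past)
along the time orientation gains `≳ √s` on the null side and loses `≲ s` on the timelike side,
contradicting maximality (1).

Everything is proved; no definitions and no named facts are introduced (D-0026).

## References

* B. O'Neill, *Semi-Riemannian geometry with applications to relativity*, Academic Press 1983,
  Ch. 10, Prop. 10.45, Prop. 10.46 (pp. 294–295); Ch. 14, Prop. 14.19 (p. 411); Ch. 5,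
  Lemma 5.33, Prop. 5.34. [ONeillSemiRiemannian1983]
-/

noncomputable section

open Bundle Set Filter Function Topology Metric
open scoped Manifold ContDiff ENNReal

namespace Literature.Geometry.Lorentzian

open Literature.Geometry.Riemannian

variable {E : Type*} [NormedAddCommGroup E] [NormedSpace ℝ E] {H : Type*} [TopologicalSpace H]
  {I : ModelWithCorners ℝ E H} {M : Type*} [TopologicalSpace M] [ChartedSpace H M]
  [IsManifold I ∞ M]

namespace LorentzianMetric

variable {n : ℕ∞ω} {g : LorentzianMetric I n M} {τ : TimeOrientation g}

/-- Continuity of the radial data of a two-point inverse `Ξ` of `exp` on `W × W`, `W` inside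
the chart domain at `c`: the functions `(x, y) ↦ g_x(v, v)` and `(x, y) ↦ g_x(T_x, v)`,
`v = e_c⁻¹(x)(Ξ x y)`, are continuous on `W × W` (read in the chart at `c`). [folklore] -/
lemma continuousOn_val_symmL_twoPoint [Fact (1 ≤ n)] (c : M) {W : Set M} {Ξ : M → M → E}
    (hWsrc : W ⊆ (chartAt H c).source)
    (hΞs : ContMDiffOn (I.prod I) 𝓘(ℝ, E) ∞ (uncurry Ξ) (W ×ˢ W)) :
    ContinuousOn (fun xy : M × M ↦
      (g.val xy.1 ((trivializationAt E (TangentSpace I : M → Type _) c).symmL ℝ xy.1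
          (Ξ xy.1 xy.2))
        ((trivializationAt E (TangentSpace I : M → Type _) c).symmL ℝ xy.1 (Ξ xy.1 xy.2)),
       g.val xy.1 (τ.vectorField xy.1)
        ((trivializationAt E (TangentSpace I : M → Type _) c).symmL ℝ xy.1 (Ξ xy.1 xy.2))))
      (W ×ˢ W) := by
  have hn1 : (1 : ℕ∞ω) ≤ n := Fact.out
  let φ := extChartAt I c
  have hφc : ContinuousOn φ (chartAt H c).source := by
    rw [← extChartAt_source I c]; exact continuousOn_extChartAt c
  have hGc : ContinuousOn (g.coordMetric c) φ.target := (g.contDiffOn_coordMetric hn1 c).continuousOn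
  have hTc : ContinuousOn (τ.coordTime c) φ.target := τ.continuousOn_coordTime hn1 c
  have hmapt : ∀ x ∈ W, φ x ∈ φ.target := fun x hx ↦
    φ.map_source (by rw [extChartAt_source]; exact hWsrc hx)
  have h1 : ContinuousOn (fun xy : M × M ↦ φ xy.1) (W ×ˢ W) :=
    hφc.comp continuous_fst.continuousOn fun xy hxy ↦ hWsrc hxy.1
  have h2 : ContinuousOn (fun xy : M × M ↦ Ξ xy.1 xy.2) (W ×ˢ W) := hΞs.continuousOn
  have h3 : ContinuousOn (fun xy : M × M ↦ g.coordMetric c (φ xy.1)) (W ×ˢ W) :=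
    hGc.comp h1 fun xy hxy ↦ hmapt _ hxy.1
  have h4 : ContinuousOn (fun xy : M × M ↦ τ.coordTime c (φ xy.1)) (W ×ˢ W) :=
    hTc.comp h1 fun xy hxy ↦ hmapt _ hxy.1
  have hQ' : ContinuousOn (fun xy : M × M ↦
      g.coordMetric c (φ xy.1) (Ξ xy.1 xy.2) (Ξ xy.1 xy.2)) (W ×ˢ W) :=
    (h3.clm_apply h2).clm_apply h2
  have hP' : ContinuousOn (fun xy : M × M ↦
      g.coordMetric c (φ xy.1) (τ.coordTime c (φ xy.1)) (Ξ xy.1 xy.2)) (W ×ˢ W) :=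
    (h3.clm_apply h4).clm_apply h2
  have hid : ∀ xy ∈ W ×ˢ W,
      g.coordMetric c (φ xy.1) (Ξ xy.1 xy.2) (Ξ xy.1 xy.2) =
        g.val xy.1 ((trivializationAt E (TangentSpace I : M → Type _) c).symmL ℝ xy.1
          (Ξ xy.1 xy.2))
          ((trivializationAt E (TangentSpace I : M → Type _) c).symmL ℝ xy.1 (Ξ xy.1 xy.2)) ∧
      g.coordMetric c (φ xy.1) (τ.coordTime c (φ xy.1)) (Ξ xy.1 xy.2) =
        g.val xy.1 (τ.vectorField xy.1)
          ((trivializationAt E (TangentSpace I : M → Type _) c).symmL ℝ xy.1 (Ξ xy.1 xy.2)) := by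
    intro xy hxy
    have hsrc : xy.1 ∈ φ.source := by rw [extChartAt_source]; exact hWsrc hxy.1
    have ht : φ xy.1 ∈ φ.target := hmapt _ hxy.1
    have hA := g.coordMetric_apply (p := c) ht (Ξ xy.1 xy.2) (Ξ xy.1 xy.2)
    have hB := coordMetric_coordTime_apply (τ := τ) (p := c) ht (Ξ xy.1 xy.2)
    rw [φ.left_inv hsrc] at hA hB
    exact ⟨hA, hB⟩
  exact ContinuousOn.prodMk (hQ'.congr fun xy hxy ↦ ((hid xy hxy).1).symm)
    (hP'.congr fun xy hxy ↦ ((hid xy hxy).2).symm)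

variable [FiniteDimensional ℝ E] [CompleteSpace E] [T2Space M] [I.Boundaryless] [g.HasLeviCivita]
  [CovariantDerivative.ContMDiffCovariantDerivative g.leviCivita 1] (τ)

set_option maxHeartbeats 4000000 in
/-- **The vertex of a locally maximal broken causal radial geodesic** (O'Neill 1983, Ch. 10,
Prop. 10.46; Ch. 14, proof of Prop. 14.19). Let `(M, g, τ)` be strongly causal (smooth metric),
`a₋ ∈ 𝓔_x` and `a₊ ∈ 𝓔_y` future-directed causal with `exp_x(a₋) = y`, and write
`σ₋(r) = exp_x(r a₋)`, `σ₊(r) = exp_y(r a₊)`. Suppose that for every `δ ∈ (0, 1)` and every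
`y'` with `σ₋(1-δ) ≤ y' ≤ σ₊(δ)` one has `τ(σ₋(1-δ), y') + τ(y', σ₊(δ)) ≤ δ|a₋| + δ|a₊|`
(`|a| = √(-g(a, a))`). Then `a₋` is timelike iff `a₊` is, and in that case
`σ₋'(1)/|a₋| = a₊/|a₊|`. See the module docstring for the proof.
[cite: ONeillSemiRiemannian1983, Ch. 10, Prop. 10.46 (p. 295); Ch. 14, Prop. 14.19 (p. 411)] -/
theorem vertex_of_maximal (hn : (∞ : ℕ∞ω) ≤ n) (hsc : g.IsStronglyCausal τ)
    {x y : M} {am : TangentSpace I x} (hamd : am ∈ expDomain g.leviCivita x)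
    (hy : expMap g.leviCivita x am = y) (ham : τ.IsFutureDirected am)
    {ap : TangentSpace I y} (hapd : ap ∈ expDomain g.leviCivita y)
    (hap : τ.IsFutureDirected ap)
    (hmax : ∀ δ ∈ Ioo (0 : ℝ) 1, ∀ y' : M,
      y' ∈ g.causalFuture τ {expMap g.leviCivita x ((1 - δ) • am)} →
      expMap g.leviCivita y (δ • ap) ∈ g.causalFuture τ {y'} →
      g.lorentzDist τ (expMap g.leviCivita x ((1 - δ) • am)) y' +
          g.lorentzDist τ y' (expMap g.leviCivita y (δ • ap)) ≤
        ENNReal.ofReal (δ * Real.sqrt (-g.val x am am) + δ * Real.sqrt (-g.val y ap ap))) :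
    (g.val x am am < 0 ↔ g.val y ap ap < 0) ∧
    (g.val y ap ap < 0 →
      (Real.sqrt (-g.val x am am))⁻¹ •
          (velocity I (fun r : ℝ ↦ expMap g.leviCivita x (r • am)) 1 : E) =
        (Real.sqrt (-g.val y ap ap))⁻¹ • (ap : E)) := by
  classical
  haveI : Fact (1 ≤ n) := ⟨le_trans (by exact_mod_cast le_top) hn⟩
  have hn1 : (1 : ℕ∞ω) ≤ n := Fact.out
  have hn2 : (2 : ℕ∞ω) ≤ n :=
    le_trans (WithTop.coe_le_coe.mpr le_top : (2 : ℕ∞ω) ≤ ((⊤ : ℕ∞) : ℕ∞ω)) hn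
  haveI := contMDiffCovariantDerivative_leviCivita_infty g.toPseudoRiemannianMetric hn
  have hcausal : g.IsCausallyWellBehaved τ :=
    IsStronglyCausal.isCausallyWellBehaved_holds (g := g) (τ := τ) hsc
  have hchron : g.IsChronological τ := hcausal.isChronological
  have hchron' : g.IsChronological τ.reverse := hcausal.reverse.isChronological
  have hnotI : ∀ p : M, p ∉ g.chronologicalFuture τ {p} := isChronological_iff.mp hchron
  have hnotI' : ∀ p : M, p ∉ g.chronologicalFuture τ.reverse {p} :=
    isChronological_iff.mp hchron'
  /- ■ the two geodesics -/
  let σm : ℝ → M := maximalGeodesic g.leviCivita x am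
  let σp : ℝ → M := maximalGeodesic g.leviCivita y ap
  obtain ⟨hMm, h0m, hσm0, hσmv⟩ := maximalGeodesic_spec' (cov := g.leviCivita) x am
  obtain ⟨hMp, h0p, hσp0, hσpv⟩ := maximalGeodesic_spec' (cov := g.leviCivita) y ap
  have hDm : Icc (0 : ℝ) 1 ⊆ maximalGeodesicDomain g.leviCivita x am := hMm.2.1.out h0m hamd.2
  have hσm0' : σm 0 = x := hσm0
  have hσp0' : σp 0 = y := hσp0
  have hσmv' : velocity I σm 0 = am := hσmv
  have hσpv' : velocity I σp 0 = ap := hσpv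
  have hDp : Icc (0 : ℝ) 1 ⊆ maximalGeodesicDomain g.leviCivita y ap := hMp.2.1.out h0p hapd.2
  -- radial form = maximal geodesic on the domain, and velocities
  have hradm : ∀ t ∈ maximalGeodesicDomain g.leviCivita x am, expMap g.leviCivita x (t • am) = σm t := fun t ht ↦
    (expMap_smul_of_mem (cov := g.leviCivita) x am ht).2
  have hradp : ∀ t ∈ maximalGeodesicDomain g.leviCivita y ap, expMap g.leviCivita y (t • ap) = σp t := fun t ht ↦
    (expMap_smul_of_mem (cov := g.leviCivita) y ap ht).2
  have hradvm : ∀ t ∈ maximalGeodesicDomain g.leviCivita x am,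
      velocity I (fun r : ℝ ↦ expMap g.leviCivita x (r • am)) t = velocity I σm t := by
    intro t ht
    refine velocity_congr_of_eventuallyEq ?_
    filter_upwards [hMm.isOpen.mem_nhds ht] with r hr using hradm r hr
  have hradvp : ∀ t ∈ maximalGeodesicDomain g.leviCivita y ap,
      velocity I (fun r : ℝ ↦ expMap g.leviCivita y (r • ap)) t = velocity I σp t := by
    intro t ht
    refine velocity_congr_of_eventuallyEq ?_
    filter_upwards [hMp.isOpen.mem_nhds ht] with r hr using hradp r hr
  have hσm1 : σm 1 = y := by rw [← hradm 1 hamd.2, one_smul]; exact hy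
  -- future-directed velocities, constant speed
  have hfdm : ∀ t ∈ maximalGeodesicDomain g.leviCivita x am, τ.IsFutureDirected (velocity I σm t) := by
    intro t ht
    rw [← hradvm t ht, ← hradm t ht]; exact isFutureDirected_velocity_expMap_smul τ ham ht
  have hfdp : ∀ t ∈ maximalGeodesicDomain g.leviCivita y ap, τ.IsFutureDirected (velocity I σp t) := by
    intro t ht
    rw [← hradvp t ht, ← hradp t ht]; exact isFutureDirected_velocity_expMap_smul τ hap ht
  have hcsm : ∀ t ∈ maximalGeodesicDomain g.leviCivita x am,
      g.val (σm t) (velocity I σm t) (velocity I σm t) = g.val x am am := by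
    intro t ht
    have h := g.toPseudoRiemannianMetric.val_velocity_eq_of_isGeodesicOn_holds hMm.isOpen
      hMm.2.1 hMm.isGeodesicOn ht h0m
    rw [hσmv, hσm0] at h
    exact h
  have hcsp : ∀ t ∈ maximalGeodesicDomain g.leviCivita y ap,
      g.val (σp t) (velocity I σp t) (velocity I σp t) = g.val y ap ap := by
    intro t ht
    have h := g.toPseudoRiemannianMetric.val_velocity_eq_of_isGeodesicOn_holds hMp.isOpen
      hMp.2.1 hMp.isGeodesicOn ht h0p
    rw [hσpv, hσp0] at h
    exact h
  -- continuity
  have hcontm : ∀ t ∈ maximalGeodesicDomain g.leviCivita x am, ContinuousAt σm t := fun t ht ↦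
    (IsGeodesicOn.mdifferentiableAt_holds hMm.isGeodesicOn ht).continuousAt
  have hcontp : ∀ t ∈ maximalGeodesicDomain g.leviCivita y ap, ContinuousAt σp t := fun t ht ↦
    (IsGeodesicOn.mdifferentiableAt_holds hMp.isGeodesicOn ht).continuousAt
  have hTLm : ContinuousOn (tangentLift I σm) (maximalGeodesicDomain g.leviCivita x am) :=
    continuousOn_tangentLift_maximalGeodesic (cov := g.leviCivita) x am
  have hTLp : ContinuousOn (tangentLift I σp) (maximalGeodesicDomain g.leviCivita y ap) :=
    continuousOn_tangentLift_maximalGeodesic (cov := g.leviCivita) y ap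
  -- the norms
  let ℓm : ℝ := Real.sqrt (-g.val x am am)
  let ℓp : ℝ := Real.sqrt (-g.val y ap ap)
  have hQam : g.val x am am ≤ 0 := ham.1.1
  have hQap : g.val y ap ap ≤ 0 := hap.1.1
  /- ■ the packages at `y` -/
  obtain ⟨W₁, Ξ₁, hW₁o, hyW₁, hW₁src, hΞ₁s, hΞ₁, hform⟩ :=
    exists_nhds_lorentzDist_eq_radial τ hn y
  obtain ⟨W₂, Src, Ξ₂, hW₂o, hyW₂, hW₂src, hSo, hS0, hSdom, hinj, hΞ₂, -, -⟩ :=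
    exists_twoPoint_expInverse (cov := g.leviCivita) y
  let e := trivializationAt E (TangentSpace I : M → Type _) y
  have hbase : e.baseSet = (chartAt H y).source := TangentBundle.trivializationAt_baseSet y
  obtain ⟨U, hUo, hyU, hUW, hUcc⟩ := hsc.exists_causallyConvex_nhds hn1 y
    (Filter.inter_mem (hW₁o.mem_nhds hyW₁) (hW₂o.mem_nhds hyW₂))
  have hUW₁ : U ⊆ W₁ := fun p hp ↦ (hUW hp).1
  have hUW₂ : U ⊆ W₂ := fun p hp ↦ (hUW hp).2
  have hform' := hform U hUW₁ hUcc
  have hQPc := continuousOn_val_symmL_twoPoint (g := g) (τ := τ) y hW₁src hΞ₁s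
  -- the matching lemma (injectivity of the two-point inverse)
  have hmatch : ∀ b : M, b ∈ e.baseSet → ∀ (ξ : E) (v : TangentSpace I b),
      (b, ξ) ∈ Src → (b, e.continuousLinearMapAt ℝ b v) ∈ Src →
      expMap g.leviCivita b (e.symmL ℝ b ξ) = expMap g.leviCivita b v → e.symmL ℝ b ξ = v := by
    intro b hb ξ v h1 h2 hexp
    have hv : e.symmL ℝ b (e.continuousLinearMapAt ℝ b v) = v := e.symmL_continuousLinearMapAt hb v
    have h := hinj h1 h2 (by
      show (b, expMap g.leviCivita b (e.symmL ℝ b ξ)) = (b, expMap g.leviCivita b (e.symmL ℝ b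
        (e.continuousLinearMapAt ℝ b v)))
      rw [hv, hexp])
    have hξ : ξ = e.continuousLinearMapAt ℝ b v := congrArg Prod.snd h
    rw [hξ, hv]
  -- `δ • ap` is future-directed for `δ > 0`
  have hfutδ : ∀ δ : ℝ, 0 < δ → τ.IsFutureDirected (x := y) (δ • ap) := by
    intro δ hδ
    have hQ : g.val y (δ • ap) (δ • ap) ≤ 0 := by
      rw [map_smul, map_smul, smul_apply, smul_eq_mul, smul_eq_mul, ← mul_assoc]
      nlinarith [mul_pos hδ hδ, hQap]
    have hT : g.val y (τ.vectorField y) (δ • ap) < 0 := by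
      rw [map_smul, smul_eq_mul]; exact mul_neg_of_pos_of_neg hδ hap.2
    exact ⟨⟨hQ, smul_ne_zero hδ.ne' hap.1.2⟩, hT⟩
  /- ■ `Ξ₁ y y = 0` (causality) -/
  have hΞyy : Ξ₁ y y = 0 := by
    let v₀ : TangentSpace I y := e.symmL ℝ y (Ξ₁ y y)
    have hv₀d : v₀ ∈ expDomain g.leviCivita y := (hΞ₁ y hyW₁ y hyW₁).1
    have hv₀e : expMap g.leviCivita y v₀ = y := (hΞ₁ y hyW₁ y hyW₁).2
    have hyb : y ∈ e.baseSet := by rw [hbase]; exact mem_chart_source H y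
    -- limits of the backward vectors from `σp δ` to `y`
    have hzlim : Tendsto σp (𝓝[>] 0) (𝓝 y) := by
      have h : Tendsto σp (𝓝 0) (𝓝 (σp 0)) := (hcontp 0 h0p).tendsto
      rw [hσp0'] at h
      exact h.mono_left nhdsWithin_le_nhds
    have hzU : ∀ᶠ δ in 𝓝[>] (0 : ℝ), σp δ ∈ U := hzlim.eventually_mem (hUo.mem_nhds hyU)
    have hzdom : ∀ᶠ δ in 𝓝[>] (0 : ℝ), δ ∈ maximalGeodesicDomain g.leviCivita y ap :=
      nhdsWithin_le_nhds (hMp.isOpen.mem_nhds h0p)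
    have hpair : ∀ᶠ δ in 𝓝[>] (0 : ℝ),
        g.val (σp δ) (e.symmL ℝ (σp δ) (Ξ₁ (σp δ) y)) (e.symmL ℝ (σp δ) (Ξ₁ (σp δ) y)) ≤ 0 ∧
        0 < g.val (σp δ) (τ.vectorField (σp δ)) (e.symmL ℝ (σp δ) (Ξ₁ (σp δ) y)) ∧
        (σp δ, y) ∈ W₁ ×ˢ W₁ := by
      filter_upwards [hzU, hzdom, self_mem_nhdsWithin] with δ hδU hδd hδ0
      have hδ0' : (0 : ℝ) < δ := hδ0
      have hdomδ : (δ • ap : TangentSpace I y) ∈ expDomain g.leviCivita y :=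
        (expMap_smul_of_mem (cov := g.leviCivita) y ap hδd).1
      have hJ : σp δ ∈ g.causalFuture τ {y} := by
        rw [← hradp δ hδd]
        exact expMap_mem_causalFuture τ hdomδ (hfutδ δ hδ0')
      have hne : σp δ ≠ y := by
        intro heq
        have hcurve := isFutureCausalCurveOn_expMap_smul τ hdomδ (hfutδ δ hδ0')
        refine hcausal _ 0 1 one_pos hcurve ?_
        show expMap g.leviCivita y ((0 : ℝ) • δ • ap) = expMap g.leviCivita y ((1 : ℝ) • δ • ap)
        rw [zero_smul, one_smul, expMap_zero, hradp δ hδd, heq]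
      obtain ⟨-, ⟨hQw, hPw⟩, -, -⟩ := hform' y hyU (σp δ) hδU hJ hne
      exact ⟨hQw, hPw, hUW₁ hδU, hyW₁⟩
    have hlim2 : Tendsto (fun δ ↦ (σp δ, y)) (𝓝[>] (0 : ℝ)) (𝓝[W₁ ×ˢ W₁] (y, y)) :=
      tendsto_nhdsWithin_iff.2 ⟨hzlim.prodMk_nhds tendsto_const_nhds,
        hpair.mono fun δ h ↦ h.2.2⟩
    have hQP := ((hQPc (y, y) ⟨hyW₁, hyW₁⟩).tendsto).comp hlim2
    have hQlim := (continuous_fst.tendsto _).comp hQP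
    have hPlim := (continuous_snd.tendsto _).comp hQP
    have hQ0 : g.val y v₀ v₀ ≤ 0 := le_of_tendsto hQlim (hpair.mono fun δ h ↦ h.1)
    have hP0 : 0 ≤ g.val y (τ.vectorField y) v₀ := ge_of_tendsto hPlim (hpair.mono fun δ h ↦ h.2.1.le)
    -- `v₀ = 0`: otherwise a closed past causal radial curve at `y`
    have hv₀ : v₀ = 0 := by
      by_contra hne
      have hc : g.IsCausal (x := y) v₀ := (g.isCausal_iff _).2 ⟨hQ0, hne⟩
      rcases τ.isFutureDirected_or_isPastDirected_of_isCausal hc with h | h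
      · exact absurd h.2 (not_lt.2 hP0)
      · have hfr : τ.reverse.IsFutureDirected (x := y) v₀ :=
          (TimeOrientation.isFutureDirected_reverse_iff τ v₀).2 h
        have hcurve := isFutureCausalCurveOn_expMap_smul τ.reverse hv₀d hfr
        refine hcausal.reverse _ 0 1 one_pos hcurve ?_
        show expMap g.leviCivita y ((0 : ℝ) • v₀) = expMap g.leviCivita y ((1 : ℝ) • v₀)
        rw [zero_smul, one_smul, expMap_zero, hv₀e]
    have h := e.continuousLinearMapAt_symmL (R := ℝ) hyb (Ξ₁ y y)
    rw [show e.symmL ℝ y (Ξ₁ y y) = 0 from hv₀, map_zero] at h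
    exact h.symm
  /- ■ choice of `δ` -/
  have hyb : y ∈ e.baseSet := by rw [hbase]; exact mem_chart_source H y
  have hS0y : (y, (0 : E)) ∈ Src := hS0 y hyW₂
  -- limits as `δ → 0⁺`
  have hzlim : Tendsto σp (𝓝[>] 0) (𝓝 y) := by
    have h : Tendsto σp (𝓝 0) (𝓝 (σp 0)) := (hcontp 0 h0p).tendsto
    rw [hσp0'] at h
    exact h.mono_left nhdsWithin_le_nhds
  have hxlim : Tendsto (fun δ : ℝ ↦ σm (1 - δ)) (𝓝[>] 0) (𝓝 y) := by
    have h1 : Tendsto (fun δ : ℝ ↦ 1 - δ) (𝓝 0) (𝓝 1) := by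
      have h := (show Continuous fun δ : ℝ ↦ 1 - δ from continuous_const.sub continuous_id).tendsto 0
      rwa [sub_zero] at h
    have h2 : Tendsto σm (𝓝 1) (𝓝 (σm 1)) := (hcontm 1 hamd.2).tendsto
    rw [hσm1] at h2
    exact (h2.comp h1).mono_left nhdsWithin_le_nhds
  have hTLlim_m : Tendsto (fun δ : ℝ ↦ (e (tangentLift I σm (1 - δ))).2) (𝓝[>] 0)
      (𝓝 ((e (tangentLift I σm 1)).2)) := by
    have h1 : Tendsto (fun δ : ℝ ↦ 1 - δ) (𝓝[>] 0)
        (𝓝[maximalGeodesicDomain g.leviCivita x am] 1) := by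
      refine tendsto_nhdsWithin_iff.2 ⟨?_, ?_⟩
      · have this : Tendsto (fun δ : ℝ ↦ 1 - δ) (𝓝 0) (𝓝 1) := by
          have h := (show Continuous fun δ : ℝ ↦ 1 - δ from
            continuous_const.sub continuous_id).tendsto 0
          rwa [sub_zero] at h
        exact this.mono_left nhdsWithin_le_nhds
      · have hev : ∀ᶠ δ in 𝓝 (0 : ℝ), 1 - δ ∈ maximalGeodesicDomain g.leviCivita x am :=
          (continuous_const.sub continuous_id).continuousAt.preimage_mem_nhds
            (hMm.isOpen.mem_nhds (by simpa using hamd.2))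
        exact nhdsWithin_le_nhds hev
    have h3 : ContinuousAt e (tangentLift I σm 1) := by
      refine e.continuousOn.continuousAt (e.open_source.mem_nhds ?_)
      rw [e.mem_source]
      show σm 1 ∈ e.baseSet
      rw [hσm1]; exact hyb
    exact (continuous_snd.tendsto _).comp ((h3.tendsto.comp (hTLm 1 hamd.2)).comp h1)
  have hTLlim_p : Tendsto (fun δ : ℝ ↦ (e (tangentLift I σp δ)).2) (𝓝[>] 0)
      (𝓝 ((e (tangentLift I σp 0)).2)) := by
    have h1 : Tendsto (fun δ : ℝ ↦ δ) (𝓝[>] 0) (𝓝[maximalGeodesicDomain g.leviCivita y ap] 0) :=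
      tendsto_nhdsWithin_iff.2 ⟨tendsto_id.mono_left nhdsWithin_le_nhds,
        nhdsWithin_le_nhds (hMp.isOpen.mem_nhds h0p)⟩
    have h3 : ContinuousAt e (tangentLift I σp 0) := by
      refine e.continuousOn.continuousAt (e.open_source.mem_nhds ?_)
      rw [e.mem_source]
      show σp 0 ∈ e.baseSet
      rw [hσp0']; exact hyb
    exact (continuous_snd.tendsto _).comp ((h3.tendsto.comp (hTLp 0 h0p)).comp h1)
  -- the eventual conditions
  have hE : ∀ᶠ δ in 𝓝[>] (0 : ℝ), δ < 1 ∧ δ ∈ maximalGeodesicDomain g.leviCivita y ap ∧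
      1 - δ ∈ maximalGeodesicDomain g.leviCivita x am ∧ σp δ ∈ U ∧ σm (1 - δ) ∈ U ∧
      (σm (1 - δ), Ξ₁ (σm (1 - δ)) y) ∈ Src ∧
      (σm (1 - δ), δ • (e (tangentLift I σm (1 - δ))).2) ∈ Src ∧
      (σp δ, Ξ₁ (σp δ) y) ∈ Src ∧
      (σp δ, (-δ) • (e (tangentLift I σp δ)).2) ∈ Src := by
    have e1 : ∀ᶠ δ in 𝓝[>] (0 : ℝ), δ < 1 := nhdsWithin_le_nhds (Iio_mem_nhds one_pos)
    have e2 : ∀ᶠ δ in 𝓝[>] (0 : ℝ), δ ∈ maximalGeodesicDomain g.leviCivita y ap :=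
      nhdsWithin_le_nhds (hMp.isOpen.mem_nhds h0p)
    have e3 : ∀ᶠ δ in 𝓝[>] (0 : ℝ), 1 - δ ∈ maximalGeodesicDomain g.leviCivita x am :=
      nhdsWithin_le_nhds ((continuous_const.sub continuous_id).continuousAt.preimage_mem_nhds
        (hMm.isOpen.mem_nhds (by simpa using hamd.2)))
    have e4 : ∀ᶠ δ in 𝓝[>] (0 : ℝ), σp δ ∈ U := hzlim.eventually_mem (hUo.mem_nhds hyU)
    have e5 : ∀ᶠ δ in 𝓝[>] (0 : ℝ), σm (1 - δ) ∈ U := hxlim.eventually_mem (hUo.mem_nhds hyU)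
    -- `Ξ₁ (·) y` along the two limits
    have hΞc : ContinuousOn (fun q : M ↦ Ξ₁ q y) W₁ := by
      have h1 : ContMDiff I (I.prod I) ∞ (fun q : M ↦ (q, y)) := contMDiff_id.prodMk contMDiff_const
      exact (hΞ₁s.comp h1.contMDiffOn fun q hq ↦ ⟨hq, hyW₁⟩).continuousOn
    have hΞca : ContinuousAt (fun q : M ↦ Ξ₁ q y) y := hΞc.continuousAt (hW₁o.mem_nhds hyW₁)
    have e6 : ∀ᶠ δ in 𝓝[>] (0 : ℝ), (σm (1 - δ), Ξ₁ (σm (1 - δ)) y) ∈ Src := by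
      have h : Tendsto (fun δ : ℝ ↦ (σm (1 - δ), Ξ₁ (σm (1 - δ)) y)) (𝓝[>] 0) (𝓝 (y, Ξ₁ y y)) :=
        hxlim.prodMk_nhds (hΞca.tendsto.comp hxlim)
      rw [hΞyy] at h
      exact h.eventually_mem (hSo.mem_nhds hS0y)
    have e8 : ∀ᶠ δ in 𝓝[>] (0 : ℝ), (σp δ, Ξ₁ (σp δ) y) ∈ Src := by
      have h : Tendsto (fun δ : ℝ ↦ (σp δ, Ξ₁ (σp δ) y)) (𝓝[>] 0) (𝓝 (y, Ξ₁ y y)) :=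
        hzlim.prodMk_nhds (hΞca.tendsto.comp hzlim)
      rw [hΞyy] at h
      exact h.eventually_mem (hSo.mem_nhds hS0y)
    have hδ0 : Tendsto (fun δ : ℝ ↦ δ) (𝓝[>] (0 : ℝ)) (𝓝 0) := tendsto_id.mono_left nhdsWithin_le_nhds
    have e7 : ∀ᶠ δ in 𝓝[>] (0 : ℝ), (σm (1 - δ), δ • (e (tangentLift I σm (1 - δ))).2) ∈ Src := by
      have h : Tendsto (fun δ : ℝ ↦ (σm (1 - δ), δ • (e (tangentLift I σm (1 - δ))).2)) (𝓝[>] 0)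
          (𝓝 (y, (0 : ℝ) • (e (tangentLift I σm 1)).2)) :=
        hxlim.prodMk_nhds (hδ0.smul hTLlim_m)
      rw [zero_smul] at h
      exact h.eventually_mem (hSo.mem_nhds hS0y)
    have e9 : ∀ᶠ δ in 𝓝[>] (0 : ℝ), (σp δ, (-δ) • (e (tangentLift I σp δ)).2) ∈ Src := by
      have h : Tendsto (fun δ : ℝ ↦ (σp δ, (-δ) • (e (tangentLift I σp δ)).2)) (𝓝[>] 0)
          (𝓝 (y, (-(0 : ℝ)) • (e (tangentLift I σp 0)).2)) :=
        hzlim.prodMk_nhds (hδ0.neg.smul hTLlim_p)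
      rw [neg_zero, zero_smul] at h
      exact h.eventually_mem (hSo.mem_nhds hS0y)
    filter_upwards [e1, e2, e3, e4, e5, e6, e7, e8, e9] with δ h1 h2 h3 h4 h5 h6 h7 h8 h9
      using ⟨h1, h2, h3, h4, h5, h6, h7, h8, h9⟩
  obtain ⟨δ, ⟨hδ1, hδd, hδd', hz'U, hx'U, hSrc1, hSrc2, hSrc3, hSrc4⟩, hδ0⟩ :=
    (hE.and self_mem_nhdsWithin).exists
  have hδ0' : (0 : ℝ) < δ := hδ0
  /- ■ the points `x' = σ₋(1-δ)`, `z' = σ₊(δ)` and the radial vectors -/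
  let x' : M := σm (1 - δ)
  let z' : M := σp δ
  have hx'W₁ : x' ∈ W₁ := hUW₁ hx'U
  have hz'W₁ : z' ∈ W₁ := hUW₁ hz'U
  have hx'b : x' ∈ e.baseSet := by rw [hbase]; exact hW₁src hx'W₁
  have hz'b : z' ∈ e.baseSet := by rw [hbase]; exact hW₁src hz'W₁
  have hx'eq : expMap g.leviCivita x ((1 - δ) • am) = x' := hradm _ hδd'
  have hz'eq : expMap g.leviCivita y (δ • ap) = z' := hradp _ hδd
  let Pm : TangentSpace I x' := velocity I σm (1 - δ)
  let Pp : TangentSpace I z' := velocity I σp δ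
  let P : TangentSpace I y := velocity I σm 1
  -- flow property at `x'`
  have h1dom : δ + (1 - δ) ∈ maximalGeodesicDomain g.leviCivita x am := by
    rw [add_sub_cancel]; exact hamd.2
  have hδPm : δ ∈ maximalGeodesicDomain g.leviCivita x' Pm :=
    (maximalGeodesic_translate (cov := g.leviCivita) x am hδd' h1dom).1
  have hexp1 : expMap g.leviCivita x' (δ • Pm) = y := by
    rw [(expMap_smul_of_mem (cov := g.leviCivita) x' Pm hδPm).2,
      maximalGeodesic_translate_apply (cov := g.leviCivita) x am hδd' h1dom, add_sub_cancel]
    exact hσm1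
  have hvel1 : (velocity I (fun r : ℝ ↦ expMap g.leviCivita x' (r • (δ • Pm))) 1 :
      TangentSpace I y) = δ • P := by
    have h1 : (velocity I (fun r : ℝ ↦ expMap g.leviCivita x' (r • (δ • Pm))) 1 : TangentSpace I y)
        = δ • (velocity I (maximalGeodesic g.leviCivita x' Pm) δ : TangentSpace I y) :=
      velocity_expMap_smul_smul_one (cov := g.leviCivita) x' Pm hδPm
    have h2 : (velocity I (maximalGeodesic g.leviCivita x' Pm) δ : TangentSpace I y) =
        (velocity I σm (δ + (1 - δ)) : TangentSpace I y) :=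
      velocity_maximalGeodesic_translate (cov := g.leviCivita) x am hδd' h1dom
    have h3 : (velocity I σm (δ + (1 - δ)) : TangentSpace I y) = P := by
      rw [add_sub_cancel]
    rw [h1, h2, h3]
    exact rfl
  have hPmdom : (δ • Pm : TangentSpace I x') ∈ expDomain g.leviCivita x' :=
    (expMap_smul_of_mem (cov := g.leviCivita) x' Pm hδPm).1
  -- flow property at `z'`
  have h0dom : -δ + δ ∈ maximalGeodesicDomain g.leviCivita y ap := by rw [neg_add_cancel]; exact h0p
  have hδPp : -δ ∈ maximalGeodesicDomain g.leviCivita z' Pp :=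
    (maximalGeodesic_translate (cov := g.leviCivita) y ap hδd h0dom).1
  have hexp2 : expMap g.leviCivita z' ((-δ) • Pp) = y := by
    rw [(expMap_smul_of_mem (cov := g.leviCivita) z' Pp hδPp).2,
      maximalGeodesic_translate_apply (cov := g.leviCivita) y ap hδd h0dom, neg_add_cancel]
    exact hσp0'
  have hvel2 : (velocity I (fun r : ℝ ↦ expMap g.leviCivita z' (r • ((-δ) • Pp))) 1 :
      TangentSpace I y) = (-δ) • ap := by
    have h1 : (velocity I (fun r : ℝ ↦ expMap g.leviCivita z' (r • ((-δ) • Pp))) 1 :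
        TangentSpace I y) =
        (-δ) • (velocity I (maximalGeodesic g.leviCivita z' Pp) (-δ) : TangentSpace I y) :=
      velocity_expMap_smul_smul_one (cov := g.leviCivita) z' Pp hδPp
    have h2 : (velocity I (maximalGeodesic g.leviCivita z' Pp) (-δ) : TangentSpace I y) =
        (velocity I σp (-δ + δ) : TangentSpace I y) :=
      velocity_maximalGeodesic_translate (cov := g.leviCivita) y ap hδd h0dom
    have h3 : (velocity I σp (-δ + δ) : TangentSpace I y) = ap := by
      rw [neg_add_cancel]; exact hσpv'
    rw [h1, h2, h3]
    exact rfl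
  -- future-directedness and causal relations of `x' ≤ y ≤ z'`
  have hPmf : τ.IsFutureDirected (x := x') (δ • Pm) := by
    have hf := hfdm (1 - δ) hδd'
    refine ⟨⟨?_, smul_ne_zero hδ0'.ne' hf.1.2⟩, ?_⟩
    · rw [map_smul, map_smul, smul_apply, smul_eq_mul, smul_eq_mul, ← mul_assoc]
      nlinarith [mul_pos hδ0' hδ0', hf.1.1]
    · rw [map_smul, smul_eq_mul]; exact mul_neg_of_pos_of_neg hδ0' hf.2
  have hyJx' : y ∈ g.causalFuture τ {x'} := by
    rw [← hexp1]; exact expMap_mem_causalFuture τ hPmdom hPmf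
  have hapδd : (δ • ap : TangentSpace I y) ∈ expDomain g.leviCivita y := (expMap_smul_of_mem (cov := g.leviCivita) y ap hδd).1
  have hz'Jy : z' ∈ g.causalFuture τ {y} := by
    rw [← hz'eq]; exact expMap_mem_causalFuture τ hapδd (hfutδ δ hδ0')
  -- the radial vectors of the package are `δ Pm` and `-δ Pp`
  have hβ10 : e.symmL ℝ x' (Ξ₁ x' y) = δ • Pm := by
    refine hmatch x' hx'b (Ξ₁ x' y) (δ • Pm) hSrc1 ?_ ?_
    · have h : e.continuousLinearMapAt ℝ x' (δ • Pm) = δ • (e (tangentLift I σm (1 - δ))).2 := by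
        rw [map_smul, e.continuousLinearMapAt_apply_of_mem (R := ℝ) hx'b]
        rfl
      rw [h]; exact hSrc2
    · rw [(hΞ₁ x' hx'W₁ y hyW₁).2, hexp1]
  have hβ20 : e.symmL ℝ z' (Ξ₁ z' y) = (-δ) • Pp := by
    refine hmatch z' hz'b (Ξ₁ z' y) ((-δ) • Pp) hSrc3 ?_ ?_
    · have h : e.continuousLinearMapAt ℝ z' ((-δ) • Pp) = (-δ) • (e (tangentLift I σp δ)).2 := by
        rw [map_smul, e.continuousLinearMapAt_apply_of_mem (R := ℝ) hz'b]
        rfl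
      rw [h]; exact hSrc4
    · rw [(hΞ₁ z' hz'W₁ y hyW₁).2, hexp2]
  -- values of the metric on them
  have hQ10 : g.val x' (δ • Pm) (δ • Pm) = δ ^ 2 * g.val x am am := by
    rw [map_smul, map_smul, smul_apply, smul_eq_mul, smul_eq_mul, ← mul_assoc, hcsm _ hδd']
    ring
  have hQ20 : g.val z' ((-δ) • Pp) ((-δ) • Pp) = δ ^ 2 * g.val y ap ap := by
    rw [map_smul, map_smul, smul_apply, smul_eq_mul, smul_eq_mul, ← mul_assoc, hcsp _ hδd]
    ring
  /- ■ the first variations along `s ↦ exp_y(s u)` -/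
  have key : ∀ u : TangentSpace I y, ∃ (c : ℝ → M) (Q₁ Q₂ : ℝ → ℝ),
      c 0 = y ∧ ContinuousAt c 0 ∧
      (∀ᶠ s in 𝓝 (0 : ℝ), (s • u : TangentSpace I y) ∈ expDomain g.leviCivita y ∧
        expMap g.leviCivita y (s • u) = c s ∧ c s ∈ U) ∧
      HasDerivAt Q₁ (2 * δ * g.val y u P) 0 ∧ HasDerivAt Q₂ (-(2 * δ) * g.val y u ap) 0 ∧
      Q₁ 0 = δ ^ 2 * g.val x am am ∧ Q₂ 0 = δ ^ 2 * g.val y ap ap ∧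
      (∀ s, c s ∈ U → c s ∈ g.causalFuture τ {x'} → c s ≠ x' →
        g.lorentzDist τ x' (c s) = ENNReal.ofReal (Real.sqrt (-Q₁ s))) ∧
      (∀ s, c s ∈ U → z' ∈ g.causalFuture τ {c s} → z' ≠ c s →
        g.lorentzDist τ (c s) z' = ENNReal.ofReal (Real.sqrt (-Q₂ s))) := by
    intro u
    let c : ℝ → M := maximalGeodesic g.leviCivita y u
    obtain ⟨hMc, h0c, hc0, hcv⟩ := maximalGeodesic_spec' (cov := g.leviCivita) y u
    have hc0' : c 0 = y := hc0
    have hcv' : velocity I c 0 = u := hcv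
    have hcc : ContinuousAt c 0 := (IsGeodesicOn.mdifferentiableAt_holds hMc.isGeodesicOn h0c).continuousAt
    have hcd : MDifferentiableAt 𝓘(ℝ, ℝ) I c 0 :=
      IsGeodesicOn.mdifferentiableAt_holds hMc.isGeodesicOn h0c
    have hcnear : ∀ᶠ s in 𝓝 (0 : ℝ), (s • u : TangentSpace I y) ∈ expDomain g.leviCivita y ∧
        expMap g.leviCivita y (s • u) = c s ∧ c s ∈ U := by
      have h1 : ∀ᶠ s in 𝓝 (0 : ℝ), s ∈ maximalGeodesicDomain g.leviCivita y u := hMc.isOpen.mem_nhds h0c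
      have h2 : ∀ᶠ s in 𝓝 (0 : ℝ), c s ∈ U := by
        have h := hcc.preimage_mem_nhds (hUo.mem_nhds (by rw [hc0']; exact hyU))
        exact h
      filter_upwards [h1, h2] with s hs hs'
      exact ⟨(expMap_smul_of_mem (cov := g.leviCivita) y u hs).1, (expMap_smul_of_mem (cov := g.leviCivita) y u hs).2, hs'⟩
    have hcW₁ : ∀ᶠ s in 𝓝 (0 : ℝ), c s ∈ W₁ := hcnear.mono fun s hs ↦ hUW₁ hs.2.2
    -- the two chart curves
    let β₁ : ℝ → E := fun s ↦ e.symmL ℝ x' (Ξ₁ x' (c s))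
    let β₂ : ℝ → E := fun s ↦ e.symmL ℝ z' (Ξ₁ z' (c s))
    have hdiff : ∀ b : M, b ∈ W₁ → ∃ β' : E, HasDerivAt (fun s ↦ (e.symmL ℝ b (Ξ₁ b (c s)) : E)) β' 0 := by
      intro b hb
      let K : M → E := fun w ↦ Ξ₁ b w
      have hKs : ContMDiffOn I 𝓘(ℝ, E) ∞ K W₁ := by
        have h1 : ContMDiff I (I.prod I) ∞ (fun w : M ↦ (b, w)) := contMDiff_const.prodMk contMDiff_id
        exact hΞ₁s.comp h1.contMDiffOn fun w hw ↦ ⟨hb, hw⟩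
      have hKd : MDifferentiableAt I 𝓘(ℝ, E) K (c 0) :=
        (hKs.contMDiffAt (hW₁o.mem_nhds (by rw [hc0']; exact hyW₁))).mdifferentiableAt (by simp)
      have h := hKd.comp 0 hcd
      have hd : DifferentiableAt ℝ (fun s ↦ K (c s)) 0 := mdifferentiableAt_iff_differentiableAt.1 h
      let L : E →L[ℝ] E := e.symmL ℝ b
      exact ⟨L (deriv (fun s ↦ K (c s)) 0), L.hasFDerivAt.comp_hasDerivAt 0 hd.hasDerivAt⟩
    obtain ⟨β₁', hβ₁⟩ := hdiff x' hx'W₁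
    obtain ⟨β₂', hβ₂⟩ := hdiff z' hz'W₁
    have hβ₁0 : β₁ 0 = δ • Pm := by show e.symmL ℝ x' (Ξ₁ x' (c 0)) = δ • Pm; rw [hc0']; exact hβ10
    have hβ₂0 : β₂ 0 = (-δ) • Pp := by show e.symmL ℝ z' (Ξ₁ z' (c 0)) = (-δ) • Pp; rw [hc0']; exact hβ20
    have hmem₁ : (β₁ 0 : TangentSpace I x') ∈ expDomain g.leviCivita x' := by rw [hβ₁0]; exact hPmdom
    have hmem₂ : (β₂ 0 : TangentSpace I z') ∈ expDomain g.leviCivita z' := by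
      rw [hβ₂0]; exact (expMap_smul_of_mem (cov := g.leviCivita) z' Pp hδPp).1
    -- `exp ∘ βᵢ = c` near `0`
    have hexpβ₁ : (fun s ↦ expMap g.leviCivita x' (β₁ s)) =ᶠ[𝓝 0] c := by
      filter_upwards [hcW₁] with s hs using (hΞ₁ x' hx'W₁ (c s) hs).2
    have hexpβ₂ : (fun s ↦ expMap g.leviCivita z' (β₂ s)) =ᶠ[𝓝 0] c := by
      filter_upwards [hcW₁] with s hs using (hΞ₁ z' hz'W₁ (c s) hs).2
    -- first variations
    have hQ₁d := hasDerivAt_val_self_radial (g := g) hn x' hβ₁ hmem₁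
    have hQ₂d := hasDerivAt_val_self_radial (g := g) hn z' hβ₂ hmem₂
    have hv₁ : velocity I (fun s ↦ expMap g.leviCivita x' (β₁ s)) 0 = u := by
      rw [← hcv']; exact velocity_congr_of_eventuallyEq hexpβ₁
    have hv₂ : velocity I (fun s ↦ expMap g.leviCivita z' (β₂ s)) 0 = u := by
      rw [← hcv']; exact velocity_congr_of_eventuallyEq hexpβ₂
    have hb₁ : expMap g.leviCivita x' (β₁ 0) = y := by rw [hβ₁0]; exact hexp1
    have hb₂ : expMap g.leviCivita z' (β₂ 0) = y := by rw [hβ₂0]; exact hexp2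
    have hw₁ : (velocity I (fun r : ℝ ↦
        expMap g.leviCivita x' ((r • β₁ 0 : E) : TangentSpace I x')) 1 : TangentSpace I y) = δ • P := by
      have : (fun r : ℝ ↦ expMap g.leviCivita x' ((r • β₁ 0 : E) : TangentSpace I x')) =
          fun r : ℝ ↦ expMap g.leviCivita x' (r • (δ • Pm)) := by
        funext r; rw [hβ₁0]; rfl
      rw [this]; exact hvel1
    have hw₂ : (velocity I (fun r : ℝ ↦
        expMap g.leviCivita z' ((r • β₂ 0 : E) : TangentSpace I z')) 1 : TangentSpace I y) =
        (-δ) • ap := by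
      have : (fun r : ℝ ↦ expMap g.leviCivita z' ((r • β₂ 0 : E) : TangentSpace I z')) =
          fun r : ℝ ↦ expMap g.leviCivita z' (r • ((-δ) • Pp)) := by
        funext r; rw [hβ₂0]; rfl
      rw [this]; exact hvel2
    rw [hv₁, hw₁, hb₁] at hQ₁d
    rw [hv₂, hw₂, hb₂] at hQ₂d
    refine ⟨c, fun s ↦ g.val x' (β₁ s) (β₁ s), fun s ↦ g.val z' (β₂ s) (β₂ s), hc0', hcc, hcnear,
      ?_, ?_, ?_, ?_, ?_, ?_⟩
    · refine hQ₁d.congr_deriv ?_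
      rw [map_smul, smul_eq_mul]; ring
    · refine hQ₂d.congr_deriv ?_
      rw [map_smul, smul_eq_mul]; ring
    · show g.val x' (β₁ 0) (β₁ 0) = _
      rw [hβ₁0]; exact hQ10
    · show g.val z' (β₂ 0) (β₂ 0) = _
      rw [hβ₂0]; exact hQ20
    · intro s hsU hJ hne
      exact (hform' x' hx'U (c s) hsU hJ hne).2.2.1
    · intro s hsU hJ hne
      exact (hform' (c s) hsU z' hz'U hJ hne).2.2.2
  /- ■ common facts for the case analysis -/
  have hD0 : ∀ {Q0 q : ℝ}, Q0 = δ ^ 2 * q → q ≤ 0 → Real.sqrt (-Q0) = δ * Real.sqrt (-q) := by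
    intro Q0 q hQ hq
    rw [hQ, show -(δ ^ 2 * q) = δ ^ 2 * (-q) by ring, Real.sqrt_mul (sq_nonneg δ),
      Real.sqrt_sq hδ0'.le]
  -- the maximality inequality in real form along a test curve
  have hΛ : ∀ (c : ℝ → M) (Q₁ Q₂ : ℝ → ℝ) (s : ℝ),
      g.lorentzDist τ x' (c s) = ENNReal.ofReal (Real.sqrt (-Q₁ s)) →
      g.lorentzDist τ (c s) z' = ENNReal.ofReal (Real.sqrt (-Q₂ s)) →
      c s ∈ g.causalFuture τ {x'} → z' ∈ g.causalFuture τ {c s} →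
      Real.sqrt (-Q₁ s) + Real.sqrt (-Q₂ s) ≤ δ * ℓm + δ * ℓp := by
    intro c Q₁ Q₂ s hd₁ hd₂ hJ₁ hJ₂
    have h := hmax δ ⟨hδ0', hδ1⟩ (c s)
    rw [hx'eq, hz'eq] at h
    have h' := h hJ₁ hJ₂
    rw [hd₁, hd₂, ← ENNReal.ofReal_add (Real.sqrt_nonneg _) (Real.sqrt_nonneg _)] at h'
    exact (ENNReal.ofReal_le_ofReal_iff (by positivity)).1 h'
  -- chronological relations when the segments are timelike
  have hyIx' : g.val x am am < 0 → y ∈ g.chronologicalFuture τ {x'} := by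
    intro hT
    have htl : g.IsTimelike (x := x') (δ • Pm) := by
      show g.val x' (δ • Pm) (δ • Pm) < 0
      rw [hQ10]; nlinarith [mul_pos hδ0' hδ0']
    rw [← hexp1]; exact expMap_mem_chronologicalFuture τ hPmdom htl hPmf
  have hz'Iy : g.val y ap ap < 0 → z' ∈ g.chronologicalFuture τ {y} := by
    intro hT
    have htl : g.IsTimelike (x := y) (δ • ap) := by
      show g.val y (δ • ap) (δ • ap) < 0
      rw [map_smul, map_smul, smul_apply, smul_eq_mul, smul_eq_mul, ← mul_assoc]
      nlinarith [mul_pos hδ0' hδ0']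
    rw [← hz'eq]; exact expMap_mem_chronologicalFuture τ hapδd htl (hfutδ δ hδ0')
  have hTP : g.val y (τ.vectorField y) P < 0 := by
    have h := (hfdm 1 hamd.2).2
    rw [hσm1] at h
    exact h
  /- ■ timelike–timelike: the unit tangents agree -/
  have hTT : g.val x am am < 0 → g.val y ap ap < 0 → (ℓm⁻¹ • P : TangentSpace I y) = ℓp⁻¹ • ap := by
    intro hTm hTp
    have hℓm : 0 < ℓm := Real.sqrt_pos.2 (by linarith)
    have hℓp : 0 < ℓp := Real.sqrt_pos.2 (by linarith)
    have hall : ∀ u : TangentSpace I y, g.val y (ℓm⁻¹ • P - ℓp⁻¹ • ap) u = 0 := by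
      intro u
      obtain ⟨c, Q₁, Q₂, hc0, hcc, hcnear, hQ₁d, hQ₂d, hQ₁0, hQ₂0, hd₁, hd₂⟩ := key u
      -- validity of the local formulas near `s = 0`
      have hO₁ : ∀ᶠ s in 𝓝 (0 : ℝ), c s ∈ g.chronologicalFuture τ {x'} := by
        have h := (isOpen_chronologicalFuture_of_boundaryless (g := g) (τ := τ) {x'}).mem_nhds
          (hyIx' hTm)
        rw [← hc0] at h
        exact hcc.preimage_mem_nhds h
      have hO₂ : ∀ᶠ s in 𝓝 (0 : ℝ), c s ∈ g.chronologicalPast τ {z'} := by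
        have h := (isOpen_chronologicalPast_of_boundaryless (g := g) (τ := τ) {z'}).mem_nhds
          (mem_chronologicalPast_of_mem_chronologicalFuture (hz'Iy hTp))
        rw [← hc0] at h
        exact hcc.preimage_mem_nhds h
      have hloc : IsLocalMax (fun s ↦ Real.sqrt (-Q₁ s) + Real.sqrt (-Q₂ s)) 0 := by
        show ∀ᶠ s in 𝓝 (0 : ℝ), Real.sqrt (-Q₁ s) + Real.sqrt (-Q₂ s) ≤
          Real.sqrt (-Q₁ 0) + Real.sqrt (-Q₂ 0)
        filter_upwards [hcnear, hO₁, hO₂] with s hs h1 h2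
        have hJ₁ : c s ∈ g.causalFuture τ {x'} := chronologicalFuture_subset_causalFuture g τ _ h1
        have hne₁ : c s ≠ x' := fun heq ↦ hnotI x' (by rw [heq] at h1; exact h1)
        have h2' : z' ∈ g.chronologicalFuture τ {c s} := mem_chronologicalFuture_of_mem_chronologicalPast h2
        have hJ₂ : z' ∈ g.causalFuture τ {c s} := chronologicalFuture_subset_causalFuture g τ _ h2'
        have hne₂ : z' ≠ c s := fun heq ↦ hnotI (c s) (by rw [heq] at h2'; exact h2')
        have h := hΛ c Q₁ Q₂ s (hd₁ s hs.2.2 hJ₁ hne₁) (hd₂ s hs.2.2 hJ₂ hne₂) hJ₁ hJ₂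
        rw [hD0 hQ₁0 hQam, hD0 hQ₂0 hQap]
        exact h
      have hs₁ : Real.sqrt (-Q₁ 0) = δ * ℓm := hD0 hQ₁0 hQam
      have hs₂ : Real.sqrt (-Q₂ 0) = δ * ℓp := hD0 hQ₂0 hQap
      have hne₁ : -Q₁ 0 ≠ 0 := by rw [hQ₁0]; nlinarith [mul_pos hδ0' hδ0']
      have hne₂ : -Q₂ 0 ≠ 0 := by rw [hQ₂0]; nlinarith [mul_pos hδ0' hδ0']
      have hD₁ := (hQ₁d.neg).sqrt hne₁
      have hD₂ := (hQ₂d.neg).sqrt hne₂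
      have hzero := hloc.hasDerivAt_eq_zero (hD₁.add hD₂)
      simp only [Pi.neg_apply] at hzero
      rw [hs₁, hs₂] at hzero
      have hδne : δ ≠ 0 := hδ0'.ne'
      have hℓmne : ℓm ≠ 0 := hℓm.ne'
      have hℓpne : ℓp ≠ 0 := hℓp.ne'
      have hA : -(2 * δ * g.val y u P) / (2 * (δ * ℓm)) = -(ℓm⁻¹ * g.val y u P) := by
        field_simp
      have hB : -(-(2 * δ) * g.val y u ap) / (2 * (δ * ℓp)) = ℓp⁻¹ * g.val y u ap := by
        field_simp
      rw [hA, hB] at hzero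
      rw [map_sub, map_smul, map_smul, sub_apply, smul_apply, smul_apply,
        smul_eq_mul, smul_eq_mul, g.symm y P u, g.symm y ap u]
      linarith
    exact sub_eq_zero.1 (g.nondegenerate y _ hall)
  /- ■ null–timelike vertices are impossible -/
  have hT : g.val y (τ.vectorField y) (τ.vectorField y) < 0 := τ.isTimelike y
  have hT'Q : g.val y (-τ.vectorField y) (-τ.vectorField y) =
      g.val y (τ.vectorField y) (τ.vectorField y) := by
    rw [map_neg, map_neg, neg_apply, neg_neg]
  -- `TN`: `a₋` timelike, `a₊` null
  have hTN : g.val x am am < 0 → g.val y ap ap = 0 → False := by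
    intro hTm hNp
    obtain ⟨c, Q₁, Q₂, hc0, hcc, hcnear, hQ₁d, hQ₂d, hQ₁0, hQ₂0, hd₁, hd₂⟩ :=
      key (-(τ.vectorField y))
    have hO₁ : ∀ᶠ s in 𝓝 (0 : ℝ), c s ∈ g.chronologicalFuture τ {x'} := by
      have h := (isOpen_chronologicalFuture_of_boundaryless (g := g) (τ := τ) {x'}).mem_nhds
        (hyIx' hTm)
      rw [← hc0] at h
      exact hcc.preimage_mem_nhds h
    have hval : ∀ᶠ s in 𝓝[>] (0 : ℝ), Real.sqrt (-Q₂ s) + Real.sqrt (-Q₁ s) ≤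
        Real.sqrt (-Q₂ 0) + Real.sqrt (-Q₁ 0) := by
      filter_upwards [nhdsWithin_le_nhds hcnear, nhdsWithin_le_nhds hO₁, self_mem_nhdsWithin]
        with s hs h1 hs0
      have hs0' : (0 : ℝ) < s := hs0
      have htl : g.IsTimelike (x := y) (s • -τ.vectorField y) := by
        show g.val y (s • -τ.vectorField y) (s • -τ.vectorField y) < 0
        rw [map_smul, map_smul, smul_apply, smul_eq_mul, smul_eq_mul, ← mul_assoc, hT'Q]
        nlinarith [mul_pos hs0' hs0', hT]
      have hfut : τ.reverse.IsFutureDirected (x := y) (s • -τ.vectorField y) := by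
        rw [TimeOrientation.isFutureDirected_reverse_iff]
        refine ⟨htl.isCausal, ?_⟩
        show 0 < g.val y (τ.vectorField y) (s • -τ.vectorField y)
        rw [map_smul, smul_eq_mul, map_neg]
        nlinarith [hs0', hT]
      have hcsI : c s ∈ g.chronologicalFuture τ.reverse {y} := by
        rw [← hs.2.1]; exact expMap_mem_chronologicalFuture τ.reverse hs.1 htl hfut
      have hyI : y ∈ g.chronologicalFuture τ {c s} :=
        mem_chronologicalFuture_of_mem_chronologicalPast hcsI
      have hz'I : z' ∈ g.chronologicalFuture τ {c s} :=
        mem_chronologicalFuture_of_mem_chronologicalFuture_of_mem_causalFuture hn1 hyI hz'Jy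
      have hJ₂ : z' ∈ g.causalFuture τ {c s} := chronologicalFuture_subset_causalFuture g τ _ hz'I
      have hne₂ : z' ≠ c s := fun heq ↦ hnotI (c s) (by rw [heq] at hz'I; exact hz'I)
      have hJ₁ : c s ∈ g.causalFuture τ {x'} := chronologicalFuture_subset_causalFuture g τ _ h1
      have hne₁ : c s ≠ x' := fun heq ↦ hnotI x' (by rw [heq] at h1; exact h1)
      have h := hΛ c Q₁ Q₂ s (hd₁ s hs.2.2 hJ₁ hne₁) (hd₂ s hs.2.2 hJ₂ hne₂) hJ₁ hJ₂
      rw [hD0 hQ₁0 hQam, hD0 hQ₂0 hQap]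
      linarith
    have hQ₂0' : Q₂ 0 = 0 := by rw [hQ₂0, hNp, mul_zero]
    have hQ₂' : -(2 * δ) * g.val y (-τ.vectorField y) ap < 0 := by
      rw [map_neg, neg_apply]
      have : g.val y (τ.vectorField y) ap < 0 := hap.2
      nlinarith
    have hgrow := sqrt_mul_sqrt_le_of_hasDerivAt_neg hQ₂d hQ₂0' hQ₂'
    have hne₁ : -Q₁ 0 ≠ 0 := by rw [hQ₁0]; nlinarith [mul_pos hδ0' hδ0']
    obtain ⟨C, -, hlip⟩ := sub_mul_abs_le_of_hasDerivAt ((hQ₁d.neg).sqrt hne₁)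
    have hlip' : ∀ᶠ s in 𝓝[>] (0 : ℝ), Real.sqrt (-Q₁ 0) - C * s ≤ Real.sqrt (-Q₁ s) := by
      filter_upwards [nhdsWithin_le_nhds hlip, self_mem_nhdsWithin] with s hs hs0
      have hs0' : (0 : ℝ) < s := hs0
      rw [abs_of_pos hs0'] at hs; exact hs
    have hD₂0 : Real.sqrt (-Q₂ 0) = 0 := by rw [hQ₂0', neg_zero, Real.sqrt_zero]
    exact not_sqrt_growth_of_le (D₁ := fun s ↦ Real.sqrt (-Q₂ s)) (D₂ := fun s ↦ Real.sqrt (-Q₁ s))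
      (Real.sqrt_pos.2 (by linarith)) hval hD₂0 hgrow hlip'
  -- `NT`: `a₋` null, `a₊` timelike
  have hNT : g.val x am am = 0 → g.val y ap ap < 0 → False := by
    intro hNm hTp
    obtain ⟨c, Q₁, Q₂, hc0, hcc, hcnear, hQ₁d, hQ₂d, hQ₁0, hQ₂0, hd₁, hd₂⟩ :=
      key (τ.vectorField y)
    have hO₂ : ∀ᶠ s in 𝓝 (0 : ℝ), c s ∈ g.chronologicalPast τ {z'} := by
      have h := (isOpen_chronologicalPast_of_boundaryless (g := g) (τ := τ) {z'}).mem_nhds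
        (mem_chronologicalPast_of_mem_chronologicalFuture (hz'Iy hTp))
      rw [← hc0] at h
      exact hcc.preimage_mem_nhds h
    have hval : ∀ᶠ s in 𝓝[>] (0 : ℝ), Real.sqrt (-Q₁ s) + Real.sqrt (-Q₂ s) ≤
        Real.sqrt (-Q₁ 0) + Real.sqrt (-Q₂ 0) := by
      filter_upwards [nhdsWithin_le_nhds hcnear, nhdsWithin_le_nhds hO₂, self_mem_nhdsWithin]
        with s hs h2 hs0
      have hs0' : (0 : ℝ) < s := hs0
      have htl : g.IsTimelike (x := y) (s • τ.vectorField y) := by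
        show g.val y (s • τ.vectorField y) (s • τ.vectorField y) < 0
        rw [map_smul, map_smul, smul_apply, smul_eq_mul, smul_eq_mul, ← mul_assoc]
        nlinarith [mul_pos hs0' hs0', hT]
      have hfut : τ.IsFutureDirected (x := y) (s • τ.vectorField y) := by
        refine ⟨htl.isCausal, ?_⟩
        show g.val y (τ.vectorField y) (s • τ.vectorField y) < 0
        rw [map_smul, smul_eq_mul]
        nlinarith [hs0', hT]
      have hcsI : c s ∈ g.chronologicalFuture τ {y} := by
        rw [← hs.2.1]; exact expMap_mem_chronologicalFuture τ hs.1 htl hfut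
      have h1 : c s ∈ g.chronologicalFuture τ {x'} :=
        mem_chronologicalFuture_of_mem_causalFuture hn1 hyJx' hcsI
      have hJ₁ : c s ∈ g.causalFuture τ {x'} := chronologicalFuture_subset_causalFuture g τ _ h1
      have hne₁ : c s ≠ x' := fun heq ↦ hnotI x' (by rw [heq] at h1; exact h1)
      have hz'I : z' ∈ g.chronologicalFuture τ {c s} :=
        mem_chronologicalFuture_of_mem_chronologicalPast h2
      have hJ₂ : z' ∈ g.causalFuture τ {c s} := chronologicalFuture_subset_causalFuture g τ _ hz'I
      have hne₂ : z' ≠ c s := fun heq ↦ hnotI (c s) (by rw [heq] at hz'I; exact hz'I)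
      have h := hΛ c Q₁ Q₂ s (hd₁ s hs.2.2 hJ₁ hne₁) (hd₂ s hs.2.2 hJ₂ hne₂) hJ₁ hJ₂
      rw [hD0 hQ₁0 hQam, hD0 hQ₂0 hQap]
      linarith
    have hQ₁0' : Q₁ 0 = 0 := by rw [hQ₁0, hNm, mul_zero]
    have hQ₁' : 2 * δ * g.val y (τ.vectorField y) P < 0 := by nlinarith [hTP, hδ0']
    have hgrow := sqrt_mul_sqrt_le_of_hasDerivAt_neg hQ₁d hQ₁0' hQ₁'
    have hne₂ : -Q₂ 0 ≠ 0 := by rw [hQ₂0]; nlinarith [mul_pos hδ0' hδ0']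
    obtain ⟨C, -, hlip⟩ := sub_mul_abs_le_of_hasDerivAt ((hQ₂d.neg).sqrt hne₂)
    have hlip' : ∀ᶠ s in 𝓝[>] (0 : ℝ), Real.sqrt (-Q₂ 0) - C * s ≤ Real.sqrt (-Q₂ s) := by
      filter_upwards [nhdsWithin_le_nhds hlip, self_mem_nhdsWithin] with s hs hs0
      have hs0' : (0 : ℝ) < s := hs0
      rw [abs_of_pos hs0'] at hs; exact hs
    have hD₁0 : Real.sqrt (-Q₁ 0) = 0 := by rw [hQ₁0', neg_zero, Real.sqrt_zero]
    exact not_sqrt_growth_of_le (D₁ := fun s ↦ Real.sqrt (-Q₁ s)) (D₂ := fun s ↦ Real.sqrt (-Q₂ s))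
      (Real.sqrt_pos.2 (by linarith)) hval hD₁0 hgrow hlip'
  /- ■ conclusion -/
  refine ⟨⟨fun hTm ↦ ?_, fun hTp ↦ ?_⟩, fun hTp ↦ ?_⟩
  · by_contra h
    exact hTN hTm (le_antisymm hQap (not_lt.1 h))
  · by_contra h
    exact hNT (le_antisymm hQam (not_lt.1 h)) hTp
  · have hTm : g.val x am am < 0 := by
      by_contra h
      exact hNT (le_antisymm hQam (not_lt.1 h)) hTp
    have h := hTT hTm hTp
    have hP : (velocity I (fun r : ℝ ↦ expMap g.leviCivita x (r • am)) 1 : TangentSpace I y) = P :=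
      hradvm 1 hamd.2
    rw [hP]
    exact h

end LorentzianMetric

end Literature.Geometry.Lorentzian

end
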